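import Literature.Analysis.FunctionSpaces.LorentzGas
import HarnessLib

/-!
# The infinite hard-sphere system: configurations, Gibbs states and Alexander's flow

Infinitely many hard spheres of diameter `ε` (mass `1`) in `ℝ^d`, `d` arbitrary (Alexander,
*Time evolution for infinitely many hard spheres*, Comm. Math. Phys. **49** (1976) 217–232):

* configurations are locally finite simple point configurations `ω : PointConfig (ℝ^d × ℝ^d)`
  of (position, velocity) pairs (`Literature.Analysis.FunctionSpaces.PointConfig`: count
  σ-algebra, translations); `IsHardCore ε ω` is Alexander's space `𝒳` (§1.4: distinct particles
  have positions at distance `≥ ε`), which forces local finiteness *in the position coordinate*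
  (`PosLocallyFinite`, his (1.1.1); `IsHardCore.posLocallyFinite`); `IsTranslationInvariant ν`;
* `IsHardSphereGibbs ε z β u μ`: `μ` is a Gibbs state of the hard-sphere gas (activity `z`,
  inverse temperature `β`, drift `u`) — the equilibrium (DLR) equations of Alexander §2.1 (2.1.1)
  via the finite-volume specification `gibbsSpec`, built exactly as the planar hard-disc
  `Literature.Barriers.AtomisticToContinuum.HardDisk.IsGibbs` (Richthammer 2007 §3.3), in phase
  space with Maxwellian velocities (`maxwellianBeta`);
* `IsInfiniteHardSphereTrajectory ε S x`: a family of particle paths `x p : ℝ → ℝ^d × ℝ^d`,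
  labelled by `p ∈ S`, solves the hard-sphere equations of motion — the clauses of the finite
  `Literature.Analysis.FluidPDE.IsHardSphereTrajectory` particle by particle (hard core at all
  times, continuous positions, free flight between contacts, pairwise non-grazing elastic
  collisions `reflectVel` from incoming left limits, right-continuous velocities) plus
  Alexander's 4.8 (a): finitely many collisions in every bounded region during every bounded
  time interval;
* `InfiniteHardSphereFlow d ε`: a *hypothesis structure* for an almost-surely defined flow on
  configurations, modelled on `HardSphereFlow` / `LorentzFlow`: a measurable good set of
  hard-sphere configurations, measurable time-`t` maps, `Φ₀ = id` and the group law along good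
  orbits, and a particle-tracking map `traj` whose image is the evolved configuration and whose
  paths form an infinite hard-sphere trajectory; predicates `Φ.IsAEDefined P`,
  `Φ.IsStationary ν` (`ν ∘ Φ_t⁻¹ = ν`), `Φ.IsEquilibriumFlow` (both, for every Gibbs state);
* named facts: **Alexander's theorem** `InfiniteHardSphereFlow.nonempty` (Thm 5.2) and the
  uniqueness of the equilibrium flow `InfiniteHardSphereFlow.unique` (Cor 5.4).

## Design choices (what is and is not claimed)

* The structure carries NO measure (unlike `LorentzFlow ε P`): Alexander constructs ONE Borel
  set `X̄` of full measure in every Gibbs state simultaneously and one flow on it (Prop 4.7,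
  Thm 5.2); being supported by / stationary for a given law are the separate predicates
  `IsAEDefined`, `IsStationary` (requested: do not bake measure preservation into the structure).
* No field `MapsTo (flow t) good good`: Alexander's Borel set `X̄` is not claimed invariant, and
  the invariant saturation `⋃ₜ Tᵗ X̄` on which `T` becomes a group (remark after Cor 5.4) is not
  claimed Borel. Hence the group law is stated for `ω ∈ good` with `flow t ω ∈ good` (on `X̄` it
  follows from uniqueness of regular solutions, Thm 5.3), and invariance holds almost surely
  under any stationary law (`flow_mem_good_ae`, `flow_add_ae`, proved here).
* Velocities are right-continuous (post-collisional value at a collision instant, pre-collisional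
  one as left limit), the convention of `IsHardSphereTrajectory`; Alexander takes incoming momenta
  at collision instants and passes to a quotient (§5.5–5.7). Mass `m = 1`, so momentum = velocity.
* The σ-algebra is the count σ-algebra of `PointConfig`; on locally finite configurations it is
  the Borel σ-algebra of the vague topology used by Alexander §1.3 (Daley–Vere-Jones II §9.1).
* Existence is vendored AS PRINTED: for Gibbs states (Alexander's abstract: "regular solutions
  exist with probability one in every equilibrium state"), not for general translation-invariant
  laws of finite density and kinetic energy (not in the source). Drift `u = 0` in the facts
  (Alexander §2.2: centred Maxwellian momenta); `IsHardSphereGibbs` allows a drift for later use.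
* Deliberately NOT here: Alexander's regularity conditions 4.8 (b) and the partial flows `T_r`
  (hard wall at `|q| = r`, frozen exterior particles, §4.1; their existence is his thesis [1]),
  hence also his finite-volume approximation `Tᵗ = lim_r T_rᵗ` (Prop 5.1, Thm 5.2); a
  compatibility statement with the free finite-`N` flow `HardSphereFlow (Euclidean.geometry d)`
  (exterior particles deleted) is not printed in the source and is not asserted.

## References

* R. Alexander, *Time evolution for infinitely many hard spheres*, Comm. Math. Phys. 49 (1976)
  217–232 (§1.1–1.4, §2.1, 4.2, 4.3, 4.7, 4.8, Prop 5.1, Thm 5.2, Thm 5.3, Cor 5.4).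
* H. Spohn, *Large Scale Dynamics of Interacting Particles* (1991), Thm 1.2 (p. 12);
  T. Richthammer, Comm. Math. Phys. 274 (2007), §3.2–3.3 (specifications of hard-core gases).
-/

open MeasureTheory Set Filter Topology Function Metric
open scoped ENNReal InnerProductSpace
open Literature.Analysis.FunctionSpaces

namespace Literature.Analysis.FluidPDE

noncomputable section

section InfiniteHardSphere

variable {d : Type*} [Fintype d]

local notation "𝔼" => EuclideanSpace ℝ d

/-! ## Hard-sphere configurations -/

/-- Local finiteness *in the position coordinate* (Alexander 1976 (1.1.1)): finitely many
particles with position in each compact `K ⊆ ℝ^d`, whatever their velocities. (`PointConfig`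
only asks finiteness on compact subsets of phase space; for hard-sphere configurations the two
agree, `IsHardCore.posLocallyFinite`.) [cite: Alexander1976, §1.1 (1.1.1)] -/
def PosLocallyFinite (ω : PointConfig (𝔼 × 𝔼)) : Prop :=
  ∀ K : Set 𝔼, IsCompact K → ((ω : Set (𝔼 × 𝔼)) ∩ Prod.fst ⁻¹' K).Finite

/-- The hard-core constraint for spheres of diameter `ε` (Alexander 1976 §1.4: the space `𝒳` —
at most one particle at any point and distinct particles at distance "not less than" `ε`; closed
condition, as in `hardSphereDomain`): distinct points of `ω` have positions at distance `≥ ε`.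
[cite: Alexander1976, §1.4] -/
def IsHardCore (ε : ℝ) (ω : PointConfig (𝔼 × 𝔼)) : Prop :=
  ∀ p ∈ ω, ∀ q ∈ ω, p ≠ q → ε ≤ ‖p.1 - q.1‖

/-- The empty configuration is a hard-sphere configuration. [folklore] -/
theorem isHardCore_empty (ε : ℝ) : IsHardCore ε (∅ : PointConfig (𝔼 × 𝔼)) :=
  fun p hp => absurd (show p ∈ (∅ : PointConfig (𝔼 × 𝔼)).carrier from hp) (by simp)

/-- The hard-core constraint is monotone in the diameter. [folklore] -/
theorem IsHardCore.mono {ε ε' : ℝ} {ω : PointConfig (𝔼 × 𝔼)} (h : IsHardCore ε ω)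
    (hε : ε' ≤ ε) : IsHardCore ε' ω :=
  fun p hp q hq hpq => hε.trans (h p hp q hq hpq)

/-- For `ε > 0` a hard-sphere configuration has at most one particle at each position
(Alexander 1976 §1.4 (a)). [cite: Alexander1976, §1.4] -/
theorem IsHardCore.injOn_fst {ε : ℝ} {ω : PointConfig (𝔼 × 𝔼)} (hε : 0 < ε)
    (h : IsHardCore ε ω) : InjOn Prod.fst (ω : Set (𝔼 × 𝔼)) := by
  intro p hp q hq hpq
  by_contra hne
  have h' := h p hp q hq hne
  rw [hpq, sub_self, norm_zero] at h'
  exact absurd h' (not_le.2 hε)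

/-- For `ε > 0` a hard-sphere configuration is locally finite in the position coordinate: the
positions above a compact set form an `ε`-separated subset of it, which is finite (an infinite
one would have an accumulation point). [cite: Alexander1976, §1.4–1.5] -/
theorem IsHardCore.posLocallyFinite {ε : ℝ} {ω : PointConfig (𝔼 × 𝔼)} (hε : 0 < ε)
    (h : IsHardCore ε ω) : PosLocallyFinite ω := by
  intro K hK
  by_contra hinf
  set S : Set (𝔼 × 𝔼) := (ω : Set (𝔼 × 𝔼)) ∩ Prod.fst ⁻¹' K with hS
  have hinj : InjOn Prod.fst S := (h.injOn_fst hε).mono inter_subset_left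
  have hA : (Prod.fst '' S).Infinite := (infinite_image_iff hinj).2 hinf
  have hAK : Prod.fst '' S ⊆ K := by
    rintro _ ⟨p, hp, rfl⟩
    exact hp.2
  obtain ⟨a, -, ha⟩ := hA.exists_accPt_of_subset_isCompact hK hAK
  rw [accPt_iff_nhds] at ha
  obtain ⟨y₁, ⟨hy₁U, hy₁A⟩, hy₁a⟩ := ha (ball a (ε / 2)) (ball_mem_nhds a (by positivity))
  obtain ⟨y₂, ⟨hy₂U, hy₂A⟩, -⟩ :=
    ha (ball a (min (ε / 2) (dist y₁ a)))
      (ball_mem_nhds a (lt_min (by positivity) (dist_pos.2 hy₁a)))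
  have h2 : dist y₂ a < ε / 2 := lt_of_lt_of_le (mem_ball.1 hy₂U) (min_le_left _ _)
  have hne : y₁ ≠ y₂ := by
    rintro rfl
    exact lt_irrefl _ (lt_of_lt_of_le (mem_ball.1 hy₂U) (min_le_right _ _))
  obtain ⟨p, hp, rfl⟩ := hy₁A
  obtain ⟨q, hq, rfl⟩ := hy₂A
  have hpq : p ≠ q := fun h' => hne (by rw [h'])
  have hfar := h p hp.1 q hq.1 hpq
  have hnear : dist p.1 q.1 < ε := by
    have := dist_triangle_right p.1 q.1 a
    linarith [mem_ball.1 hy₁U]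
  rw [dist_eq_norm] at hnear
  exact absurd hfar (not_le.2 hnear)

/-- Translations (of positions and/or velocities) preserve the hard-core constraint. [folklore] -/
theorem IsHardCore.translate {ε : ℝ} {ω : PointConfig (𝔼 × 𝔼)} (h : IsHardCore ε ω) (v : 𝔼 × 𝔼) :
    IsHardCore ε (ω.translate v) := by
  intro p' hp' q' hq' hpq
  obtain ⟨p, hp, rfl⟩ := (show p' ∈ (ω.translate v).carrier from hp')
  obtain ⟨q, hq, rfl⟩ := (show q' ∈ (ω.translate v).carrier from hq')
  have hne : p ≠ q := fun h' => hpq (by rw [h'])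
  simpa [Prod.fst_add, add_sub_add_right_eq_sub] using h p hp q hq hne

/-- A law `ν` on configurations is *translation invariant* (in space): invariant under
`ω ↦ ω + (a, 0)` for every `a ∈ ℝ^d` (Dobrushin–Sinai–Sukhov, *Dynamical systems of statistical
mechanics*, §4.1; Gibbs states in the uniqueness regime are examples). [folklore] -/
def IsTranslationInvariant (ν : Measure (PointConfig (𝔼 × 𝔼))) : Prop :=
  ∀ a : 𝔼, ν.map (PointConfig.translate ((a, 0) : 𝔼 × 𝔼)) = ν

/-! ## Gibbs states of the hard-sphere gas (Alexander 1976 §2.1) -/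

/-- The configuration `(x ∩ Λ) ∪ (Y ∩ Λᶜ)` (positions in / outside the window `Λ ⊆ ℝ^d`): `k`
labelled particles thrown into `Λ`, superposed with the boundary condition `Y` outside `Λ`
(Richthammer 2007 §3.2, here in phase space). [cite: Richthammer2007, §3.2 (p. 6)] -/
def superposeIn (Λ : Set 𝔼) {k : ℕ} (x : Fin k → 𝔼 × 𝔼)
    (Y : PointConfig (𝔼 × 𝔼)) : PointConfig (𝔼 × 𝔼) where
  carrier := (Set.range x ∩ Prod.fst ⁻¹' Λ) ∪ ((Y : Set (𝔼 × 𝔼)) ∩ Prod.fst ⁻¹' Λᶜ)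
  finite_inter_isCompact K hK := by
    rw [Set.union_inter_distrib_right]
    exact ((Set.finite_range x).subset fun p hp => hp.1.1).union
      ((Y.finite_inter_isCompact K hK).subset fun p hp => ⟨hp.1.1, hp.2⟩)

/-- The hard-core constraint *in the window* `Λ`: pairs of distinct particles at least one of
which has its position in `Λ` are at distance `≥ ε` (the pairs entering the Hamiltonian `H_Λ`;
Richthammer 2007 §3.3, Alexander 1976 §2.1). [cite: Richthammer2007, §3.3 (pp. 6–7)] -/
def HardCoreIn (ε : ℝ) (Λ : Set 𝔼) (X : PointConfig (𝔼 × 𝔼)) : Prop :=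
  ∀ p ∈ X, ∀ q ∈ X, p ≠ q → (p.1 ∈ Λ ∨ q.1 ∈ Λ) → ε ≤ ‖p.1 - q.1‖

/-- The one-particle a priori measure in the window `Λ`: Lebesgue measure on `Λ` for the
position times the Maxwellian law `M_β(v - u) dv` (inverse temperature `β`, drift `u`,
mass `1`; `maxwellianBeta`) for the velocity (Alexander 1976 §2.2; Spohn 1991 (2.33)–(2.34)).
[cite: Alexander1976, §2.2] -/
def maxwellPhaseMeasure (β : ℝ) (u : 𝔼) (Λ : Set 𝔼) : Measure (𝔼 × 𝔼) :=
  ((volume : Measure 𝔼).restrict Λ).prod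
    ((volume : Measure 𝔼).withDensity fun v => ENNReal.ofReal (maxwellianBeta β (v - u)))

/-- The un-normalised grand-canonical weight of the event `A` in the window `Λ` with boundary
condition `Y`, activity `z`, inverse temperature `β`, drift `u`:
`∑ₖ (zᵏ/k!) ∫ 1_A(X) 1[HardCoreIn ε Λ X] ∏ᵢ dqᵢ M_β(vᵢ - u) dvᵢ`, `X = superposeIn Λ q Y`
(Alexander 1976 (2.1.1); Richthammer 2007 §3.2–3.3; the Poisson factor `e^{-z|Λ|}` cancels on
normalising). [cite: Alexander1976, §2.1 (2.1.1)] -/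
def gibbsWeight (ε z β : ℝ) (u : 𝔼) (Λ : Set 𝔼) (Y : PointConfig (𝔼 × 𝔼))
    (A : Set (PointConfig (𝔼 × 𝔼))) : ℝ≥0∞ :=
  ∑' k : ℕ, ENNReal.ofReal (z ^ k / (Nat.factorial k)) *
    ∫⁻ x : Fin k → 𝔼 × 𝔼, (A ∩ {X | HardCoreIn ε Λ X}).indicator 1 (superposeIn Λ x Y)
      ∂(Measure.pi fun _ : Fin k => maxwellPhaseMeasure β u Λ)

/-- The finite-volume Gibbs specification `γ_Λ(A | Y) = weight(A) / weight(univ)` of the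
hard-sphere gas: the conditional law of the configuration in `Λ × ℝ^d` given the configuration
`Y` outside (Alexander 1976 §2.1: "the Equilibrium Equations just determine the conditional
distribution for `x` in `𝒳_Δ` given `x` in `𝒳_{Δᶜ}`"). [cite: Alexander1976, §2.1] -/
def gibbsSpec (ε z β : ℝ) (u : 𝔼) (Λ : Set 𝔼) (Y : PointConfig (𝔼 × 𝔼))
    (A : Set (PointConfig (𝔼 × 𝔼))) : ℝ≥0∞ :=
  gibbsWeight ε z β u Λ Y A / gibbsWeight ε z β u Λ Y univ

/-- **Gibbs states of the hard-sphere gas** (diameter `ε`, activity `z`, inverse temperature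
`β`, drift `u`; mass `1`): probability laws `μ` on configurations satisfying the equilibrium
(DLR) equations `μ(A) = ∫ γ_Λ(A | Y) μ(dY)` for every bounded measurable window `Λ ⊆ ℝ^d` and
measurable `A` (Alexander 1976 §2.1 (2.1.1), with centred Maxwellian momenta, `u = 0`; the
drift is the Galilean parameter `p₀` of Dobrushin–Sinai–Sukhov §4.1). Such a `μ` is carried by
hard-sphere configurations. [cite: Alexander1976, §2.1 (2.1.1)] -/
def IsHardSphereGibbs (ε z β : ℝ) (u : 𝔼) (μ : Measure (PointConfig (𝔼 × 𝔼))) : Prop :=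
  IsProbabilityMeasure μ ∧
    ∀ Λ : Set 𝔼, MeasurableSet Λ → Bornology.IsBounded Λ →
      ∀ A : Set (PointConfig (𝔼 × 𝔼)), MeasurableSet A → μ A = ∫⁻ Y, gibbsSpec ε z β u Λ Y A ∂μ

/-! ## Infinite hard-sphere trajectories (Alexander 1976, 4.2 and 4.8 (a)) -/

/-- The collision (contact) events of a family of particle paths `x p : ℝ → ℝ^d × ℝ^d` labelled by
`p ∈ S`: pairs (label, time) at which that particle touches another one,
`‖x_p(t) - x_q(t)‖ = ε` for some `q ∈ S`, `q ≠ p`. [folklore] -/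
def collisionEvents (ε : ℝ) (S : Set (𝔼 × 𝔼)) (x : 𝔼 × 𝔼 → ℝ → 𝔼 × 𝔼) : Set ((𝔼 × 𝔼) × ℝ) :=
  {e | e.1 ∈ S ∧ ∃ q ∈ S, q ≠ e.1 ∧ ‖(x e.1 e.2).1 - (x q e.2).1‖ = ε}

/-- Membership in the set of collision events. [folklore] -/
theorem mem_collisionEvents {ε : ℝ} {S : Set (𝔼 × 𝔼)} {x : 𝔼 × 𝔼 → ℝ → 𝔼 × 𝔼} {e : (𝔼 × 𝔼) × ℝ} :
    e ∈ collisionEvents ε S x ↔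
      e.1 ∈ S ∧ ∃ q ∈ S, q ≠ e.1 ∧ ‖(x e.1 e.2).1 - (x q e.2).1‖ = ε :=
  Iff.rfl

/-- The family of particle paths `x p = (q_p, v_p) : ℝ → ℝ^d × ℝ^d`, `p ∈ S` (labels; in the flow
`S` is the initial configuration and `p` the initial phase point), is a solution of the equations
of motion of the infinite hard-sphere system with diameter `ε` and mass `1` (Alexander 1976 (0.1.2),
4.2, 4.8 (a)), clause by clause as the finite `IsHardSphereTrajectory`: the configuration is a
hard-sphere configuration at all times; only finitely many collisions occur in any bounded region
during any bounded time interval (4.8 (a)); positions are continuous; each particle is in free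
flight `(q + (t - s) v, v)` on each of its collision-free intervals `(s, t]` (so velocities are
right-continuous); and at a contact of `p` with `q` the collision is pairwise (no third particle
touches `p`) and non-grazing, the incoming velocities `v_p⁻, v_q⁻` exist as left limits with
`⟪q_p - q_q, v_p⁻ - v_q⁻⟫ < 0`, and the outgoing velocity of `p` is given by the elastic reflection
law `reflectVel (q_p - q_q) (v_p⁻, v_q⁻)` (4.2: the set `𝒮`; elastic reflection (0.1.2)).
[cite: Alexander1976, §4.2 and Def. 4.8 (a)] -/
structure IsInfiniteHardSphereTrajectory (ε : ℝ) (S : Set (𝔼 × 𝔼)) (x : 𝔼 × 𝔼 → ℝ → 𝔼 × 𝔼) :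
    Prop where
  /-- Hard core at all times: distinct particles stay at distance `≥ ε`. -/
  hardCore : ∀ t, ∀ p ∈ S, ∀ q ∈ S, p ≠ q → ε ≤ ‖(x p t).1 - (x q t).1‖
  /-- Finitely many collisions in any bounded region during any bounded time interval. -/
  locFinite : ∀ r a b : ℝ,
    (collisionEvents ε S x ∩ {e | ‖(x e.1 e.2).1‖ ≤ r ∧ e.2 ∈ Icc a b}).Finite
  /-- Positions are continuous in time. -/
  pos_continuous : ∀ p ∈ S, Continuous fun t => (x p t).1
  /-- Free flight of each particle on its collision-free intervals `(s, t]`. -/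
  free : ∀ p ∈ S, ∀ s t, s ≤ t → (∀ τ ∈ Ioc s t, (p, τ) ∉ collisionEvents ε S x) →
    x p t = ((x p s).1 + (t - s) • (x p s).2, (x p s).2)
  /-- Collisions are pairwise, non-grazing, from incoming left limits, by the elastic law. -/
  binary : ∀ p ∈ S, ∀ q ∈ S, p ≠ q → ∀ t, ‖(x p t).1 - (x q t).1‖ = ε →
    (∀ q' ∈ S, q' ≠ p → ‖(x p t).1 - (x q' t).1‖ = ε → q' = q) ∧
    ∃ vp vq : 𝔼, Tendsto (fun s => (x p s).2) (𝓝[<] t) (𝓝 vp) ∧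
      Tendsto (fun s => (x q s).2) (𝓝[<] t) (𝓝 vq) ∧
      ⟪(x p t).1 - (x q t).1, vp - vq⟫_ℝ < 0 ∧
      (x p t).2 = (reflectVel ((x p t).1 - (x q t).1) (vp, vq)).1

/-! ## The infinite hard-sphere flow (hypothesis structure) -/

variable (d) in
/-- An almost-surely defined flow of the infinite hard-sphere system with diameter `ε` in `ℝ^d`,
bundled with its defining properties, modelled on `HardSphereFlow` / `LorentzFlow` and on
Alexander's Thm 5.2: a measurable *good set* of hard-sphere configurations, measurable time-`t`
maps `flow t` with `Φ₀ = id` on `good` and the group law `Φ_{s+t} ω = Φ_s (Φ_t ω)` whenever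
`ω, Φ_t ω ∈ good` (invariance of `good` is not a field, see the module docstring; it holds a.s.,
`flow_mem_good_ae`), and a particle-tracking map `traj ω p : ℝ → ℝ^d × ℝ^d` (the path of the
particle of `ω` initially at the phase point `p`) such that `Φ_t ω` is the configuration
`{traj ω p t | p ∈ ω}`, tracking is consistent with the group law, and the paths solve the
equations of motion (`IsInfiniteHardSphereTrajectory`). Values of `flow t` off `good` and of
`traj ω p` for `p ∉ ω` are unspecified junk. [cite: Alexander1976, Thm. 5.2 and §5.4] -/
structure InfiniteHardSphereFlow (ε : ℝ) where
  /-- The flow map `(t, ω) ↦ Φ_t ω` on configurations. -/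
  flow : ℝ → PointConfig (𝔼 × 𝔼) → PointConfig (𝔼 × 𝔼)
  /-- Particle tracking: `traj ω p t` is the phase point at time `t` of the particle of `ω`
  that is at `p` at time `0`. -/
  traj : PointConfig (𝔼 × 𝔼) → 𝔼 × 𝔼 → ℝ → 𝔼 × 𝔼
  /-- The good set of initial configurations on which the dynamics is globally defined. -/
  good : Set (PointConfig (𝔼 × 𝔼))
  /-- The good set is measurable. -/
  measurableSet_good : MeasurableSet good
  /-- Good configurations are hard-sphere configurations. -/
  good_subset : good ⊆ {ω | IsHardCore ε ω}
  /-- Each time-`t` map is measurable. -/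
  measurable_flow : ∀ t, Measurable (flow t)
  /-- `Φ_0 = id` on the good set. -/
  flow_zero : ∀ ω ∈ good, flow 0 ω = ω
  /-- The group property along good orbits. -/
  flow_add : ∀ s t, ∀ ω ∈ good, flow t ω ∈ good → flow (s + t) ω = flow s (flow t ω)
  /-- Labels are the initial phase points. -/
  traj_zero : ∀ ω ∈ good, ∀ p ∈ ω, traj ω p 0 = p
  /-- The evolved configuration is the set of evolved particles. -/
  coe_flow : ∀ ω ∈ good, ∀ t,
    ((flow t ω : PointConfig (𝔼 × 𝔼)) : Set (𝔼 × 𝔼)) = (fun p => traj ω p t) '' (ω : Set (𝔼 × 𝔼))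
  /-- Tracking is consistent with the group law along good orbits. -/
  traj_flow : ∀ s t, ∀ ω ∈ good, flow t ω ∈ good → ∀ p ∈ ω,
    traj (flow t ω) (traj ω p t) s = traj ω p (s + t)
  /-- The particle paths of a good configuration solve the equations of motion. -/
  isTrajectory : ∀ ω ∈ good, IsInfiniteHardSphereTrajectory ε (ω : Set (𝔼 × 𝔼)) (traj ω)

namespace InfiniteHardSphereFlow

variable {ε : ℝ}

/-- The flow is defined `P`-almost everywhere: `P`-a.e. configuration is good (for Alexander's
flow and every Gibbs state: Prop 4.7, Thm 5.2). [cite: Alexander1976, Prop. 4.7] -/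
def IsAEDefined (Φ : InfiniteHardSphereFlow d ε) (P : Measure (PointConfig (𝔼 × 𝔼))) : Prop :=
  ∀ᵐ ω ∂P, ω ∈ Φ.good

/-- The law `ν` is stationary (invariant) under the flow: `ν ∘ Φ_t⁻¹ = ν` for all `t`
(Alexander 1976 Thm 5.2: "leaving all Gibbs states invariant"). [cite: Alexander1976, Thm. 5.2] -/
def IsStationary (Φ : InfiniteHardSphereFlow d ε) (ν : Measure (PointConfig (𝔼 × 𝔼))) : Prop :=
  ∀ t, ν.map (Φ.flow t) = ν

/-- An *equilibrium flow*: a.e. defined and stationary for every Gibbs state of the hard-sphere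
gas with diameter `ε` (all activities `z > 0`, inverse temperatures `β > 0`, zero drift) — the
two properties Alexander's Thm 5.2 asserts of `Tᵗ = lim_r T_rᵗ`. [cite: Alexander1976, Thm. 5.2] -/
def IsEquilibriumFlow (Φ : InfiniteHardSphereFlow d ε) : Prop :=
  ∀ z β : ℝ, 0 < z → 0 < β → ∀ μ : Measure (PointConfig (𝔼 × 𝔼)),
    IsHardSphereGibbs ε z β 0 μ → Φ.IsAEDefined μ ∧ Φ.IsStationary μ

variable {Φ : InfiniteHardSphereFlow d ε}
  {P : Measure (PointConfig (EuclideanSpace ℝ d × EuclideanSpace ℝ d))} -- no notation here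

/-- Good configurations are hard-sphere configurations. [folklore] -/
theorem isHardCore_of_mem_good {ω : PointConfig (𝔼 × 𝔼)} (hω : ω ∈ Φ.good) : IsHardCore ε ω :=
  Φ.good_subset hω

/-- If the flow is `P`-a.e. defined, the complement of the good set is `P`-null. [folklore] -/
theorem IsAEDefined.measure_compl_good (h : Φ.IsAEDefined P) : P Φ.goodᶜ = 0 := by
  rw [IsAEDefined, ae_iff] at h
  simpa only [compl_def] using h

/-- A stationary law is preserved by every time-`t` map (Mathlib's `MeasurePreserving`).
[folklore] -/
theorem IsStationary.measurePreserving (h : Φ.IsStationary P) (t : ℝ) :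
    MeasurePreserving (Φ.flow t) P P :=
  ⟨Φ.measurable_flow t, h t⟩

/-- Almost-sure invariance of the good set: under an a.e. defined stationary law, `Φ_t ω` is
good for `P`-a.e. `ω`. [folklore] -/
theorem flow_mem_good_ae (hP : Φ.IsAEDefined P) (hS : Φ.IsStationary P) (t : ℝ) :
    ∀ᵐ ω ∂P, Φ.flow t ω ∈ Φ.good := by
  have h1 : P (Φ.flow t ⁻¹' Φ.goodᶜ) = 0 := by
    rw [← Measure.map_apply (Φ.measurable_flow t) Φ.measurableSet_good.compl, hS t]
    exact hP.measure_compl_good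
  rw [ae_iff]
  exact h1

/-- The group law holds `P`-almost surely for each pair of times under an a.e. defined stationary
law. [folklore] -/
theorem flow_add_ae (hP : Φ.IsAEDefined P) (hS : Φ.IsStationary P) (s t : ℝ) :
    ∀ᵐ ω ∂P, Φ.flow (s + t) ω = Φ.flow s (Φ.flow t ω) := by
  filter_upwards [hP, Φ.flow_mem_good_ae hP hS t] with ω hω hω'
  exact Φ.flow_add s t ω hω hω'

end InfiniteHardSphereFlow

/-! ## Alexander's theorem (named facts) -/

/-- **Alexander's theorem** (existence of the time evolution of infinitely many hard spheres;
Alexander 1976 Thm 5.2 with Prop 4.3 (b), Prop 4.7 and §5.4): for every diameter `ε > 0` (any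
dimension) there is an infinite hard-sphere flow — Alexander's `Tᵗ = lim_r T_rᵗ` on the Borel
set `X̄` — which is almost everywhere defined and stationary for EVERY Gibbs state of the
hard-sphere gas, i.e. for all activities `z > 0` and inverse temperatures `β > 0` (centred
Maxwellian momenta): "regular solutions exist with probability one in every equilibrium state …
Equilibrium states are invariant under the time-evolution". (Stated with the right-continuous
velocity convention of this file; cf. Spohn 1991 Thm 1.2 (i).) [cite: Alexander1976, Thm. 5.2] -/
def InfiniteHardSphereFlow.nonempty : Prop :=
  ∀ {ε : ℝ}, 0 < ε → ∃ Φ : InfiniteHardSphereFlow d ε, Φ.IsEquilibriumFlow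

/-- **Uniqueness of the equilibrium time evolution** (Alexander 1976 Cor 5.4, from Prop 4.9 and
the uniqueness of regular solutions, Thm 5.3): a one-parameter group of transformations given by
solutions of the equations of motion and leaving all Gibbs states invariant agrees with the flow
`Tᵗ` of Thm 5.2 for all times, off a set that is null for every Gibbs state ("non-regular
solutions exist, but cannot be pieced together to make a measure-preserving flow"). Alexander's
`Tᵗ` is itself defined only on the conull Borel set `X̄`, and his proof uses exactly that orbits
solve the equations of motion almost surely and that Gibbs states are preserved, i.e.
`IsEquilibriumFlow`; comparing two such flows with `Tᵗ` gives the symmetric form below.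
[cite: Alexander1976, Cor. 5.4] -/
def InfiniteHardSphereFlow.unique : Prop :=
  ∀ {ε : ℝ}, 0 < ε → ∀ Φ Ψ : InfiniteHardSphereFlow d ε, Φ.IsEquilibriumFlow → Ψ.IsEquilibriumFlow →
    ∀ z β : ℝ, 0 < z → 0 < β → ∀ μ : Measure (PointConfig (𝔼 × 𝔼)),
      IsHardSphereGibbs ε z β 0 μ → ∀ᵐ ω ∂μ, ∀ t, Φ.flow t ω = Ψ.flow t ω

end InfiniteHardSphere

end
end Literature.Analysis.FluidPDE
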